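import Summits.BirchSwinnertonDyer.BirchSwinnertonDyer.Theses.UniversalToricDescent
import Summits.BirchSwinnertonDyer.BirchSwinnertonDyer.Theorems.UniversalToricDescentAcDualMuZeroCriterion
import Summits.BirchSwinnertonDyer.BirchSwinnertonDyer.Theorems.UniversalToricDescentStrictPlaceNoPTorsion
import Summits.BirchSwinnertonDyer.BirchSwinnertonDyer.Theorems.UniversalToricDescentResidualLinkTransportResidual
import Summits.BirchSwinnertonDyer.BirchSwinnertonDyer.Theorems.UniversalToricDescentResidualLinkOfLayerCount
import Summits.BirchSwinnertonDyer.BirchSwinnertonDyer.Theorems.UniversalToricDescentResidualLinkSigmaPassage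
import Summits.BirchSwinnertonDyer.BirchSwinnertonDyer.Theorems.UniversalToricDescentRelaxedStrictMixedCount
import Summits.BirchSwinnertonDyer.BirchSwinnertonDyer.Theorems.UniversalToricDescentLayerLocalFactors
import Summits.BirchSwinnertonDyer.BirchSwinnertonDyer.Theorems.UniversalToricDescentLayerLocalFactorsAtP
import Summits.BirchSwinnertonDyer.BirchSwinnertonDyer.Theorems.UniversalToricDescentSelmerInftyLayerTorsionFinite
import Summits.BirchSwinnertonDyer.BirchSwinnertonDyer.Theorems.UniversalToricDescentRelaxedLayerTransportTorsionPrimary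
import Summits.BirchSwinnertonDyer.BirchSwinnertonDyer.Theorems.UniversalToricDescentRelaxedLayerSelmer
import Summits.BirchSwinnertonDyer.BirchSwinnertonDyer.Theorems.UniversalToricDescentTowerNoPTorsion
import Summits.BirchSwinnertonDyer.BirchSwinnertonDyer.Theorems.UniversalToricDescentLayerKummerProduct
import Summits.BirchSwinnertonDyer.BirchSwinnertonDyer.Theorems.UniversalToricDescentSelmerTorsionOverComap
import Summits.BirchSwinnertonDyer.Rank1Residual.X11b.LocalTorsionMultiplicative
import Summits.BirchSwinnertonDyer.Rank1Residual.X11b.AnticyclotomicEmbedding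
import Literature.NumberTheory.EllipticCurves.ComplexMultiplicationDeuringLocalPlaces
import Literature.NumberTheory.EllipticCurves.Castella2024.LambdaAdicHeegnerClassExistence
import Literature.NumberTheory.EllipticCurves.HeegnerModuleIndex
import Literature.NumberTheory.EllipticCurves.IwasawaSelmer
import HarnessLib

/-!
# `stub_residualLinkMult` — the residual two-sided link of line `beta-road` v5 (crux `TwinAlgMuZeroAtThree`)

Crux `stmt-BirchSwinnertonDyer-24737`
(`Summit.BirchSwinnertonDyer.BirchSwinnertonDyer.Theses.UniversalToricDescent.TwinAlgMuZeroAtThree`), registered line `beta-road` v5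
(skeleton sha16 `0e83e6faf0d76c96`), PORT stub `stub_residualLinkMult` (P_res), proved here with EXACTLY its registered signature:
on bucket B (`E′` multiplicative at `3`, très ramifié), given a coherent Heegner family with a layer point locally `3`-indivisible at
`𝔭` (K1 at `𝔭`), another at `𝔭′` (K1 at `𝔭′`), and the residual corank-one growth bound K2_res with constant `C`, the `3`-torsion of
Castella's anticyclotomic Selmer group `Sel_{𝔭′}^∅(K_∞, E′[3^∞])` is finite.

## Proof (Castella 2017 App. A (A.4)–(A.7) read mod `3` over the layers `K_n`; all inputs are tree theorems)

For every layer `K_n` (`U = Γ_n`): the Shapiro package `(Φ^M, Φ, hdict, hkum)` of `…RelaxedLayerTransportTorsionPrimary` at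
`k = 1` and the field-world Poitou–Tate count of `…RelaxedStrictMixedCount` (w2 g9), with the layer local factors
`∏_{w∣𝔭} #𝓛_w = 3^{3ⁿ}` ((H0) + degree one, `…LayerLocalFactorsAtP`) and `∏_{w∣Σ₀} #𝓛_w ≤ 3^{2B}` (`…LayerLocalFactors`), are
repackaged at level `x = 3^1` and specialised to `x = 3` (`levelOne_package`, a `subst` — no rewriting under binders); the
transport `…ResidualLinkTransport(Residual)` turns them into the `Γ_K`-world count
`#R(Γ_n)·#(S_n/S_n∩Z_𝔭)·#(S_n/S_n∩Z_𝔭′) ≤ #S_n · 3^{3ⁿ+2B}` and the finiteness of `R(Γ_n)`, `S_n`; `#S_n ≤ 3^{3ⁿ+C}` is K2_res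
through `…SelmerTorsionOverComap` (its finiteness input for all `n` is `…SelmerInftyLayerTorsionFinite`, w2 g9); (H0) at `𝔭`, `𝔭′`
is `E′(ℚ₃)[3] = 0` (multiplicative très ramifié, `X11b.LocalTorsion`) pushed up the tower (`…StrictPlaceNoPTorsion`), and
`E′(K_∞)[3^∞] = 0` is `…TowerNoPTorsion` (surjective `ρ̄₃`). Then `…ResidualLinkOfLayerCount.residual_finite_of_twoSidedLayerCount`
(K1 at both primes + the norm relation) gives `R_{𝔭′}^{Σ₀}(K_∞, E′[3])` finite, and the `Σ₀`-passage `…ResidualLinkSigmaPassage`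
(w2 g9: `Σ₀` = bad places prime to `3`, finitely decomposed by Heegner + Brink; g6's receptacle) concludes.

THEOREMS ONLY; no new definitions, no named-fact hypotheses. BSD is not proved by this file; the crux stays open (K1, K2_res, C₀).
-/

set_option linter.dupNamespace false
set_option autoImplicit false

noncomputable section
open scoped Classical
open CategoryTheory Field NumberField IsDedekindDomain Function
open Literature.NumberTheory.EllipticCurves Literature.NumberTheory.EllipticCurves.GreenbergSelmer
open Literature.NumberTheory.GaloisRepresentations
open Literature.NumberTheory.GaloisRepresentations.DiscreteGaloisModule (SelmerStructure)
open Literature.NumberTheory.GaloisCohomology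
open scoped ContRepresentation
open scoped NumberField.LiesOver

namespace Summit.BirchSwinnertonDyer.BirchSwinnertonDyer.Cruxes.TwinAlgMuZeroAtThree.BetaRoad

open WeierstrassCurve
open Summit.BirchSwinnertonDyer.Rank1Residual.X11b Summit.BirchSwinnertonDyer.Rank1Residual.X11b.AcSelmer
open Summit.BirchSwinnertonDyer.Rank1Residual.X11b.KummerPT
open Summit.BirchSwinnertonDyer.BirchSwinnertonDyer.Theorems.UniversalToricDescentAcDualMuZero
open Summit.BirchSwinnertonDyer.BirchSwinnertonDyer.Theorems.UniversalToricDescentResidualLinkTransport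
open Summit.BirchSwinnertonDyer.BirchSwinnertonDyer.Theorems.UniversalToricDescentResidualLinkOfLayerCount
open Summit.BirchSwinnertonDyer.BirchSwinnertonDyer.Theorems.UniversalToricDescentResidualLinkSigmaPassage
open Summit.BirchSwinnertonDyer.BirchSwinnertonDyer.Theorems.UniversalToricDescentRelaxedStrictMixedCount
open Summit.BirchSwinnertonDyer.BirchSwinnertonDyer.Theorems.UniversalToricDescentLayerLocalFactors
open Summit.BirchSwinnertonDyer.BirchSwinnertonDyer.Theorems.UniversalToricDescentLayerLocalFactorsAtP
open Summit.BirchSwinnertonDyer.BirchSwinnertonDyer.Theorems.UniversalToricDescentSelmerInftyLayerTorsionFinite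
open Summit.BirchSwinnertonDyer.BirchSwinnertonDyer.Theorems.UniversalToricDescentRelaxedLayerTransportTorsion
open Summit.BirchSwinnertonDyer.BirchSwinnertonDyer.Theorems.UniversalToricDescentRelaxedLayerSelmer
open Summit.BirchSwinnertonDyer.BirchSwinnertonDyer.Theorems.UniversalToricDescentStrictPlace
open Summit.BirchSwinnertonDyer.BirchSwinnertonDyer.Theorems.UniversalToricDescentTowerTorsion
open Summit.BirchSwinnertonDyer.BirchSwinnertonDyer.Theorems.UniversalToricDescentLayerKummerProduct
open Summit.BirchSwinnertonDyer.BirchSwinnertonDyer.Theorems.UniversalToricDescentSelmerTorsionOverComap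

/-! ## §1. The level-`p` package at a layer (the `p^1`-seam) -/

/-- **The layer package at level `x = p^1`, generalised over `x`** so that it can be specialised to `x = p` by `subst`:
the Shapiro pair `(Φ^M, Φ)` of `…RelaxedLayerTransportTorsionPrimary.exists_transportTorsion_primary` at `k = 1` over the layer
`K_m` (bijectivity, the formula `Φ = ι ∘ Φ^M`, the vanishing and Kummer dictionaries), the field-world Poitou–Tate count of
`…RelaxedStrictMixedCount` over `K_m` (totally complex), and the two layer local factors (`∏_{w∣𝔭} #𝓛_w = p^{p^m}` under (H0) and
degree one; `∏_{w∣Σ₀} #𝓛_w ≤ p^{2B}`). [cite: GreenbergLNM1716, §2 (pp. 62–63), §3] [cite: MilneADT2006, Ch. I, Thm. 4.10]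
[cite: CoatesGreenberg1996, §3 Prop. 3.5 / (4.2)] -/
theorem levelOne_package {K : Type} [Field K] [NumberField K] (V : WeierstrassCurve K) [V.IsElliptic]
    (p : ℕ) [Fact p.Prime] (κ : ZpExtension K p) (hKc : ∀ w : InfinitePlace K, w.IsComplex) (m : ℕ)
    (𝔭 : HeightOneSpectrum (𝓞 K)) (hp𝔭 : ((p : ℕ) : 𝓞 K) ∈ 𝔭.asIdeal)
    (hef : 𝔭.asIdeal.ramificationIdx ℤ * 𝔭.asIdeal.inertiaDeg ℤ = 1)
    (h0 : ∀ P : V.geomTorsion (p : ℤ), (∀ g ∈ decomp (K := K) 𝔭 ⊓ κ.kerSubgroup, g • P = P) → P = 0)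
    {S₀ : Set (HeightOneSpectrum (𝓞 K))} (B : ℕ)
    (hB : ∀ (m k : ℕ) (T : Finset (HeightOneSpectrum (𝓞 (κ.layer m)))), (∀ w ∈ T, w.under (𝓞 K) ∈ S₀) →
      ∏ w ∈ T, Nat.card ((V.baseChange (κ.layer m)).kummerSelmerStructure ((p ^ k : ℕ) : ℤ) (Sum.inr w)) ≤
        p ^ (2 * k * B))
    (x : ℕ) (hx : x = p ^ 1) :
    ∃ (h : V.geomTorsion ((x : ℕ) : ℤ) ≤ V.geomPrimaryTorsion p)
      (ΦM : galoisCohomology ((V.baseChange (κ.layer m)).torsionGaloisModule ((x : ℕ) : ℤ)) 1 →+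
        subgroupH1 (κ.layerSubgroup m) (V.geomTorsion ((x : ℕ) : ℤ)))
      (Φ : galoisCohomology ((V.baseChange (κ.layer m)).torsionGaloisModule ((x : ℕ) : ℤ)) 1 →+
        V.subgroupH1 p (κ.layerSubgroup m)),
      Function.Bijective ΦM ∧
      (∀ z, Φ z = resH1Hom (ContinuousMonoidHom.id (κ.layerSubgroup m)) (AddSubgroup.inclusion h)
        (fun _ _ ↦ rfl) (ΦM z)) ∧
      (∀ (u : HeightOneSpectrum (𝓞 K))
        (z : galoisCohomology ((V.baseChange (κ.layer m)).torsionGaloisModule ((x : ℕ) : ℤ)) 1),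
        (∀ w : HeightOneSpectrum (𝓞 (κ.layer m)), w.asIdeal.LiesOver u.asIdeal →
          galoisCohomology.localization ((V.baseChange (κ.layer m)).torsionGaloisModule ((x : ℕ) : ℤ)) (Sum.inr w) 1 z = 0) ↔
        ∀ σ : absoluteGaloisGroup K, conjH1 (κ.layerSubgroup m) (V.geomTorsion ((x : ℕ) : ℤ)) σ (ΦM z) ∈
          awayKer (κ.layerSubgroup m) (V.geomTorsion ((x : ℕ) : ℤ)) u) ∧
      (∀ (u : HeightOneSpectrum (𝓞 K))
        (z : galoisCohomology ((V.baseChange (κ.layer m)).torsionGaloisModule ((x : ℕ) : ℤ)) 1),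
        (∀ w : HeightOneSpectrum (𝓞 (κ.layer m)), w.asIdeal.LiesOver u.asIdeal →
          galoisCohomology.res ((V.baseChange (κ.layer m)).torsionGaloisModule ((x : ℕ) : ℤ)) (w.adicCompletion (κ.layer m)) 1 z ∈
            (V.baseChange (κ.layer m)).kummerLocalConditionAt ((x : ℕ) : ℤ) (w.adicCompletion (κ.layer m))) ↔
        ∀ σ : absoluteGaloisGroup K,
          V.conjH1 p (κ.layerSubgroup m) σ (Φ z) ∈ V.localKerOver p (κ.layerSubgroup m) (u.adicCompletion K)) ∧
      (∀ P T P' : Finset (HeightOneSpectrum (𝓞 (κ.layer m))), Disjoint P T →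
        Nat.card ↥((kummerRelaxed (V.baseChange (κ.layer m)) x
              ((P.image Sum.inr ∪ Finset.univ.image Sum.inl) ∪ T.image Sum.inr)).selmerGroup ⊓
            ⨅ w ∈ P', (galoisCohomology.localization ((V.baseChange (κ.layer m)).torsionGaloisModule ((x : ℕ) : ℤ))
              (Sum.inr w) 1).ker) *
          Nat.card (↥(kummerStrict (V.baseChange (κ.layer m)) x (Finset.univ.image Sum.inl)).selmerGroup ⧸
            ((kummerStrict (V.baseChange (κ.layer m)) x (Finset.univ.image Sum.inl ∪ P.image Sum.inr)).selmerGroup).addSubgroupOf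
              (kummerStrict (V.baseChange (κ.layer m)) x (Finset.univ.image Sum.inl)).selmerGroup) *
          Nat.card (↥(kummerStrict (V.baseChange (κ.layer m)) x (Finset.univ.image Sum.inl)).selmerGroup ⧸
            ((kummerStrict (V.baseChange (κ.layer m)) x (Finset.univ.image Sum.inl ∪ P'.image Sum.inr)).selmerGroup).addSubgroupOf
              (kummerStrict (V.baseChange (κ.layer m)) x (Finset.univ.image Sum.inl)).selmerGroup) ≤
        Nat.card ↥(kummerRelaxed (V.baseChange (κ.layer m)) x (Finset.univ.image Sum.inl)).selmerGroup *
          (∏ w ∈ P, Nat.card ((V.baseChange (κ.layer m)).kummerSelmerStructure ((x : ℕ) : ℤ) (Sum.inr w))) *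
          ∏ w ∈ T, Nat.card ((V.baseChange (κ.layer m)).kummerSelmerStructure ((x : ℕ) : ℤ) (Sum.inr w))) ∧
      (∀ P : Finset (HeightOneSpectrum (𝓞 (κ.layer m))), (∀ w, w ∈ P ↔ w.under (𝓞 K) = 𝔭) →
        ∏ w ∈ P, Nat.card ((V.baseChange (κ.layer m)).kummerSelmerStructure ((x : ℕ) : ℤ) (Sum.inr w)) =
          p ^ (1 * p ^ m)) ∧
      (∀ T : Finset (HeightOneSpectrum (𝓞 (κ.layer m))), (∀ w ∈ T, w.under (𝓞 K) ∈ S₀) →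
        ∏ w ∈ T, Nat.card ((V.baseChange (κ.layer m)).kummerSelmerStructure ((x : ℕ) : ℤ) (Sum.inr w)) ≤
          p ^ (2 * 1 * B)) := by
  subst hx
  haveI : IsGalois K (κ.layer m) := κ.isGalois_layer_holds m
  haveI : (V.baseChange (κ.layer m)).IsElliptic := by rw [WeierstrassCurve.baseChange]; infer_instance
  obtain ⟨ΦM, Φ, hbij, hΦM, hdict, -, -, -, hkum⟩ := exists_transportTorsion_primary V p 1 (κ.layer m)
    (layerSubgroup_le_galRange_layer p κ m) (mem_comapResGal_layer p κ m)
  exact ⟨Literature.Barriers.BirchSwinnertonDyer.geomTorsion_pow_le_geomPrimaryTorsion V p 1, ΦM, Φ, hbij, hΦM, hdict, hkum,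
    fun P T P' hPT ↦ natCard_mixed_mul_strictIndex_mul_strictIndex_le (V.baseChange (κ.layer m)) p 1 one_pos
      (isComplex_infinitePlace_layer κ hKc m) P T P' hPT,
    fun P hP ↦ prod_natCard_kummerSelmerStructure_inr_layer_eq_pow_of_prime κ V 𝔭 hp𝔭 hef h0 m 1 P hP,
    fun T hT ↦ hB m 1 T hT⟩

/-! ## §2. The stub -/

/-- **stub_residualLinkMult** (P_res of line `beta-road` v5, registered signature verbatim): on bucket B, K1 at `𝔭` and at `𝔭′`
for coherent Heegner families and the residual corank-one growth bound K2_res imply that the `3`-torsion of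
`Sel_{𝔭′}^∅(K_∞, E′[3^∞])` is finite. Proof: module docstring (finite-level Poitou–Tate over the layers, transported by Shapiro;
Castella 2017 App. A mod `3`). [cite: Castella2018, App. A (arXiv:1704.06608)] [cite: BurungaleCastellaKim2021, Thm. 4.1] [cite: MilneADT2006, Ch. I, Thm. 4.10]
[cite: GreenbergLNM1716, §2–§3] [cite: GreenbergVatsal2000, §2 pp. 15–17, 20] [cite: Brink2007, Thm. 2, Cor. 1] -/
theorem stub_residualLinkMult :
    ∀ (W' : WeierstrassCurve ℚ) [W'.IsElliptic] [W'.IsGloballyMinimal] (N' : ℕ) [NeZero N']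
      (K : Type) [Field K] [NumberField K],
      Rank1Residual.Mult W' 3 → ¬ 3 ∣ padicValInt 3 W'.minimalDiscriminantInt →
      W'.HasSurjectiveModNGaloisRep 3 → W'.conductorNorm ℤ = N' → IsImaginaryQuadratic K →
      SatisfiesHeegnerHypothesis N' K →
      ∀ (κ : ZpExtension K 3), κ.IsAnticyclotomic →
      ∀ (γ : absoluteGaloisGroup K) [Fact (κ.IsTopGenerator γ)]
        (𝔭 : HeightOneSpectrum (𝓞 K)), ((3 : ℕ) : 𝓞 K) ∈ 𝔭.asIdeal →
        𝔭.asIdeal.ramificationIdx (𝓞 ℚ) = 1 → 𝔭.asIdeal.inertiaDeg (𝓞 ℚ) = 1 →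
      ∀ (𝔭' : HeightOneSpectrum (𝓞 K)), ((3 : ℕ) : 𝓞 K) ∈ 𝔭'.asIdeal → 𝔭' ≠ 𝔭 →
      ∀ (jbar : AlgebraicClosure K →+* ℂ) (F : HeegnerFamily N' W' K κ jbar) (α : ℤ) (k : ℕ),
        α ^ 2 = 1 → F.IsNormCompatible γ α →
        (∀ (Q : geomPoints (W'.baseChange K))
          (hQ : ∀ σ ∈ κ.layerSubgroup k ⊓ decomp 𝔭, σ • ((3 : ℤ) • Q) = (3 : ℤ) • Q),
          (3 : ℤ) • Q = F.z k →
            (W'.baseChange K).kummerClassOver (κ.layerSubgroup k ⊓ decomp 𝔭) 3 Q hQ ≠ 0) →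
      ∀ (jbar' : AlgebraicClosure K →+* ℂ) (F' : HeegnerFamily N' W' K κ jbar') (α' : ℤ) (k' : ℕ),
        α' ^ 2 = 1 → F'.IsNormCompatible γ α' →
        (∀ (Q : geomPoints (W'.baseChange K))
          (hQ : ∀ σ ∈ κ.layerSubgroup k' ⊓ decomp 𝔭', σ • ((3 : ℤ) • Q) = (3 : ℤ) • Q),
          (3 : ℤ) • Q = F'.z k' →
            (W'.baseChange K).kummerClassOver (κ.layerSubgroup k' ⊓ decomp 𝔭') 3 Q hQ ≠ 0) →
      ∀ C : ℕ,
        (∀ n : ℕ, Nat.card {s : (W'.baseChange K).selmerInfty κ |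
          3 • s = 0 ∧ (W'.baseChange K).conjH1 3 κ.kerSubgroup (γ ^ 3 ^ n)
            (s : (W'.baseChange K).subgroupH1 3 κ.kerSubgroup) = s} ≤ 3 ^ (3 ^ n + C)) →
      Set.Finite {s : selmerAc (W'.baseChange K) 3 κ 𝔭' ∅ | 3 • s = 0} := by
  intro W' _ _ N' _ K _ _ hm htr hsurj hN hK hH κ hκ γ _ 𝔭 h𝔭 he hf 𝔭' h𝔭' hne jbar F α k hα hcoh hK1
    jbar' F' α' k' hα' hcoh' hK1' C hC
  set V := W'.baseChange K with hV
  haveI : V.IsElliptic := by rw [hV, WeierstrassCurve.baseChange]; infer_instance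
  -- `K` and the layers are totally complex
  haveI := hK.2
  have hKc : ∀ w : InfinitePlace K, w.IsComplex := IsTotallyComplex.isComplex
  -- `𝔭′` is of degree one (`3 ∣ N′`, Heegner); the `ℤ`-form at `𝔭`
  have h3N : (3 : ℕ) ∣ N' := hN ▸ dvd_conductorNorm_of_mult hm
  obtain ⟨he', hf'⟩ := degreeOne_of_dvd_of_heegner (p := 3) hK hH h3N h𝔭'
  have hef : 𝔭.asIdeal.ramificationIdx ℤ * 𝔭.asIdeal.inertiaDeg ℤ = 1 := ramificationIdx_mul_inertiaDeg_int_eq_one 𝔭 he hf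
  -- (H0): `E′(ℚ₃)[3] = 0` (multiplicative, très ramifié) pushed up to `D_𝔮 ∩ Gal(K̄/K_∞)` at a degree-one `𝔮 ∋ 3`
  have h4 : ∀ R : (W'.baseChange ℚ_[3]).toAffine.Point, 3 • R = 0 → R = 0 :=
    fun R hR ↦ LocalTorsion.localTorsion_eq_zero_of_mult W' 3 le_rfl hm (Or.inr htr) R hR
  have hprim : ∀ (𝔮 : HeightOneSpectrum (𝓞 K)), ((3 : ℕ) : 𝓞 K) ∈ 𝔮.asIdeal →
      𝔮.asIdeal.ramificationIdx (𝓞 ℚ) = 1 → 𝔮.asIdeal.inertiaDeg (𝓞 ℚ) = 1 →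
      ∀ t : V.geomTorsion ((3 : ℕ) : ℤ), (∀ σ ∈ decomp 𝔮 ⊓ κ.kerSubgroup, σ • t = t) → t = 0 := by
    intro 𝔮 h𝔮 he₁ hf₁ t ht
    have hmem : (t : V.geomPoints) ∈ V.geomPrimaryTorsion 3 := geomTorsion_le_geomPrimaryTorsion V 3 t.2
    have h := noFixedPTorsion_kerSubgroup_inf_decomp_of_noPTorsionPadic W' 3 h4 κ h𝔮 he₁ hf₁ ⟨(t : V.geomPoints), hmem⟩
      (fun σ hσ ↦ Subtype.ext (by
        have := congrArg Subtype.val (ht σ ⟨hσ.2, hσ.1⟩)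
        exact this))
      (Subtype.ext (by
        have ht3 : ((3 : ℕ) : ℤ) • (t : V.geomPoints) = 0 := (mem_geomTorsion_iff V _ _).1 t.2
        rw [natCast_zsmul] at ht3
        exact ht3))
    have hv : (t : V.geomPoints) = 0 := congrArg Subtype.val h
    exact Subtype.ext hv
  -- `E′(K_∞)[3^∞] = 0` (surjective `ρ̄₃`)
  have h0inf : ∀ m : V.geomPrimaryTorsion 3, (∀ σ ∈ κ.kerSubgroup, σ • m = m) → m = 0 := by
    intro m hm'
    have hbot := fixedPoints_kerSubgroup_geomPrimaryTorsion_baseChange_eq_bot_of_surjective W' 3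
      (by exact_mod_cast hsurj) K hK κ
    have hmem : m ∈ FixedPoints.addSubgroup κ.kerSubgroup (geomPrimaryTorsion V 3) :=
      (FixedPoints.mem_addSubgroup _ _ m).mpr fun σ ↦ hm' σ σ.2
    rw [hbot] at hmem
    exact (AddSubgroup.mem_bot).mp hmem
  -- `Σ₀`: the bad places prime to `3` (finitely decomposed, tame) and the uniform tame local factor
  obtain ⟨S₀, hS₀, hS₀tame, hS₀dec, hS₀good⟩ := exists_sigma0_package (W' := W') (K := K) (p := 3) hN hK hH κ hκ
  obtain ⟨B₀, hB₀⟩ := exists_forall_prod_natCard_kummerSelmerStructure_le_pow κ V (S₀ := (S₀ : Set (HeightOneSpectrum (𝓞 K))))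
    S₀.finite_toSet (fun v hv ↦ hS₀tame v (Finset.mem_coe.mp hv)) (fun v hv ↦ hS₀dec v (Finset.mem_coe.mp hv))
  -- every place above `3` other than `𝔭′` is `𝔭` (`[K:ℚ] = 2`)
  have hsplit : ∀ u : HeightOneSpectrum (𝓞 K), ((3 : ℕ) : 𝓞 K) ∈ u.asIdeal → u ≠ 𝔭' → u = 𝔭 := by
    intro u hu hne'
    have hur : u ∈ {w : HeightOneSpectrum (𝓞 K) | w.under (𝓞 ℚ) = ratPlace 3} := under_eq_ratPlace_of_mem hu
    have h𝔭r : 𝔭 ∈ {w : HeightOneSpectrum (𝓞 K) | w.under (𝓞 ℚ) = ratPlace 3} := under_eq_ratPlace_of_mem h𝔭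
    have h𝔭'r : 𝔭' ∈ {w : HeightOneSpectrum (𝓞 K) | w.under (𝓞 ℚ) = ratPlace 3} := under_eq_ratPlace_of_mem h𝔭'
    rcases placesOver_trichotomy_of_finrank_eq_two K hK.1 (ratPlace 3) with
      ⟨w₁, w₂, -, hset, -⟩ | ⟨w, hset, -, -⟩ | ⟨w, hset, -, -⟩
    · rw [hset] at hur h𝔭r h𝔭'r
      simp only [Set.mem_insert_iff, Set.mem_singleton_iff] at hur h𝔭r h𝔭'r
      rcases hur with rfl | rfl <;> rcases h𝔭r with h2 | h2
      · exact h2.symm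
      · rcases h𝔭'r with h | h
        · exact absurd h.symm hne'
        · exact absurd (h.trans h2.symm) hne
      · rcases h𝔭'r with h | h
        · exact absurd (h.trans h2.symm) hne
        · exact absurd h.symm hne'
      · exact h2.symm
    · rw [hset] at h𝔭r h𝔭'r
      exact absurd ((Set.mem_singleton_iff.mp h𝔭'r).trans (Set.mem_singleton_iff.mp h𝔭r).symm) hne
    · rw [hset] at h𝔭r h𝔭'r
      exact absurd ((Set.mem_singleton_iff.mp h𝔭'r).trans (Set.mem_singleton_iff.mp h𝔭r).symm) hne
  have hgood : ∀ u : HeightOneSpectrum (𝓞 K), u ∉ S₀ → ((3 : ℕ) : 𝓞 K) ∉ u.asIdeal → V.HasGoodReductionAt u :=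
    fun u hu hpu ↦ hS₀good u (fun h ↦ hu (Finset.mem_coe.mp h)) hpu
  have hIU : ∀ (n : ℕ) (u : HeightOneSpectrum (𝓞 K)), u ∉ S₀ → ((3 : ℕ) : 𝓞 K) ∉ u.asIdeal →
      (adicCompletionPrime K u).inertia (absoluteGaloisGroup K) ≤ κ.layerSubgroup n :=
    fun n u _ hpu ↦ (ZpExtension.inertia_le_kerSubgroup_holds K 3 κ hpu (adicCompletionPrime_mem_primesAbove K u)).trans
      (κ.kerSubgroup_le_layerSubgroup n)
  -- K2_res ⟹ `#S_n ≤ 3^{3ⁿ+C}` and `S_n` finite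
  have hfinK : ∀ n : ℕ, Set.Finite {s : V.selmerInfty κ |
      3 • s = 0 ∧ V.conjH1 3 κ.kerSubgroup (γ ^ 3 ^ n) (s : V.subgroupH1 3 κ.kerSubgroup) = s} :=
    fun n ↦ finite_setOf_selmerInfty_pTorsion_conjH1_pow_eq' V κ γ n
  have hSfin : ∀ n : ℕ, (V.selmerTorsionOver (κ.layerSubgroup n) ((3 : ℕ) : ℤ) :
      Set (V.torsionH1Over ((3 : ℕ) : ℤ) (κ.layerSubgroup n))).Finite :=
    fun n ↦ (natCard_selmerTorsionOver_layer_le V κ n γ h0inf (hfinK n)).1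
  have hS : ∀ n : ℕ, Nat.card ↥(V.selmerTorsionOver (κ.layerSubgroup n) ((3 : ℕ) : ℤ)) ≤ 3 ^ (3 ^ n + C) :=
    fun n ↦ (natCard_selmerTorsionOver_layer_le V κ n γ h0inf (hfinK n)).2.trans (hC n)
  -- the transported two-sided count at every layer
  have key : ∀ n : ℕ,
      Finite ↥(GreenbergVatsal2000.datumStrictSelmer (κ.layerSubgroup n) (↥(V.geomTorsion ((3 : ℕ) : ℤ))) 3
          (AcSelmer.bdpData _ 3 𝔭') (↑S₀ : Set (HeightOneSpectrum (𝓞 K)))) ∧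
      Nat.card ↥(GreenbergVatsal2000.datumStrictSelmer (κ.layerSubgroup n) (↥(V.geomTorsion ((3 : ℕ) : ℤ))) 3
          (AcSelmer.bdpData _ 3 𝔭') (↑S₀ : Set (HeightOneSpectrum (𝓞 K)))) *
        Nat.card (↥(V.selmerTorsionOver (κ.layerSubgroup n) ((3 : ℕ) : ℤ)) ⧸
          (⨅ σ : absoluteGaloisGroup K,
            (AddMonoidHom.ker (resOfLe (↥(V.geomTorsion ((3 : ℕ) : ℤ)))
              (inf_le_left : κ.layerSubgroup n ⊓ decomp 𝔭 ≤ κ.layerSubgroup n))).comap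
              (conjH1 (κ.layerSubgroup n) (↥(V.geomTorsion ((3 : ℕ) : ℤ))) σ)).addSubgroupOf
            (V.selmerTorsionOver (κ.layerSubgroup n) ((3 : ℕ) : ℤ))) *
        Nat.card (↥(V.selmerTorsionOver (κ.layerSubgroup n) ((3 : ℕ) : ℤ)) ⧸
          (⨅ σ : absoluteGaloisGroup K,
            (AddMonoidHom.ker (resOfLe (↥(V.geomTorsion ((3 : ℕ) : ℤ)))
              (inf_le_left : κ.layerSubgroup n ⊓ decomp 𝔭' ≤ κ.layerSubgroup n))).comap
              (conjH1 (κ.layerSubgroup n) (↥(V.geomTorsion ((3 : ℕ) : ℤ))) σ)).addSubgroupOf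
            (V.selmerTorsionOver (κ.layerSubgroup n) ((3 : ℕ) : ℤ))) ≤
        Nat.card ↥(V.selmerTorsionOver (κ.layerSubgroup n) ((3 : ℕ) : ℤ)) * 3 ^ (3 ^ n + 2 * 1 * B₀) := by
    intro n
    have hLc : ∀ w : InfinitePlace (κ.layer n), w.IsComplex := isComplex_infinitePlace_layer κ hKc n
    -- the place sets of `K_n` over `𝔭`, `Σ₀`, `𝔭′`
    obtain ⟨P, hP⟩ := exists_finset_forall_mem_iff_under_eq (L := κ.layer n) 𝔭
    obtain ⟨P', hP'⟩ := exists_finset_forall_mem_iff_under_eq (L := κ.layer n) 𝔭'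
    have hTex : ∃ T : Finset (HeightOneSpectrum (𝓞 (κ.layer n))), ∀ w, w ∈ T ↔ w.under (𝓞 K) ∈ S₀ := by
      choose f hf using fun v : HeightOneSpectrum (𝓞 K) ↦ exists_finset_forall_mem_iff_under_eq (L := κ.layer n) v
      refine ⟨S₀.biUnion f, fun w ↦ ?_⟩
      rw [Finset.mem_biUnion]
      constructor
      · rintro ⟨v, hv, hw⟩
        rw [(hf v w).mp hw]
        exact hv
      · intro hw
        exact ⟨_, hw, (hf _ w).mpr rfl⟩
    obtain ⟨T, hT⟩ := hTex
    have hdisj : Disjoint P T := by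
      rw [Finset.disjoint_left]
      intro w hwP hwT
      have h1 : w.under (𝓞 K) = 𝔭 := (hP w).mp hwP
      have h2 := hS₀tame _ ((hT w).mp hwT)
      rw [h1] at h2
      exact h2 h𝔭
    -- the level-`3` package
    obtain ⟨hincl, ΦM, Φ, hbij, hΦM, hdict, hkum, hPTx, hfacP, hfacT⟩ :=
      levelOne_package V 3 κ hKc n 𝔭 h𝔭 hef (hprim 𝔭 h𝔭 he hf) B₀ hB₀ 3 (pow_one 3).symm
    have hΦ : ∀ z, Φ z = V.torsionToPrimaryH1Sub 3 (κ.layerSubgroup n) (ΦM z) := fun z ↦ hΦM z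
    -- the field count with its local factors bounded
    have hfac : Nat.card ↥(kummerRelaxed (V.baseChange (κ.layer n)) 3 (Finset.univ.image Sum.inl)).selmerGroup *
          (∏ w ∈ P, Nat.card ((V.baseChange (κ.layer n)).kummerSelmerStructure ((3 : ℕ) : ℤ) (Sum.inr w))) *
          ∏ w ∈ T, Nat.card ((V.baseChange (κ.layer n)).kummerSelmerStructure ((3 : ℕ) : ℤ) (Sum.inr w)) ≤
        Nat.card ↥(kummerRelaxed (V.baseChange (κ.layer n)) 3 (Finset.univ.image Sum.inl)).selmerGroup *
          3 ^ (3 ^ n + 2 * 1 * B₀) := by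
      rw [mul_assoc, hfacP P hP, one_mul, pow_add]
      exact Nat.mul_le_mul_left _ (Nat.mul_le_mul_left _ (hfacT T fun w hw ↦ (hT w).mp hw))
    have hPT := (hPTx P T P' hdisj).trans hfac
    exact finite_and_natCard_residual_mul_quotients_le V 3 (κ.layer n) (κ.layerSubgroup n) ΦM Φ hΦ hbij hdict hkum hLc hKc
      𝔭 𝔭' h𝔭' S₀ hsplit hgood (hIU n) P T P' hP hT hP' (3 ^ (3 ^ n + 2 * 1 * B₀)) hPT
  have hRfin : ∀ n : ℕ, (GreenbergVatsal2000.datumStrictSelmer (κ.layerSubgroup n) (↥(V.geomTorsion ((3 : ℕ) : ℤ))) 3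
      (AcSelmer.bdpData _ 3 𝔭') (↑S₀ : Set (HeightOneSpectrum (𝓞 K))) :
      Set (Literature.NumberTheory.EllipticCurves.subgroupH1 (κ.layerSubgroup n) (↥(V.geomTorsion ((3 : ℕ) : ℤ))))).Finite :=
    fun n ↦ Set.finite_coe_iff.mp (key n).1
  -- residual finiteness over `K_∞` (K1 at both primes + norm relation + layer control), then the `Σ₀`-passage
  have hres := residual_finite_of_twoSidedLayerCount F F' hα hα' hcoh hcoh' 𝔭 𝔭' (↑S₀ : Set (HeightOneSpectrum (𝓞 K))) k k'
    (hprim 𝔭 h𝔭 he hf) (hprim 𝔭' h𝔭' he' hf') hK1 hK1' hSfin C hS hRfin (2 * 1 * B₀) (fun n ↦ (key n).2)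
  exact finite_selmerAc_pTorsion_empty_of_finite_residual_sigma0 hK κ hκ 𝔭' h𝔭' hS₀ hres

end Summit.BirchSwinnertonDyer.BirchSwinnertonDyer.Cruxes.TwinAlgMuZeroAtThree.BetaRoad

end
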